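import Literature.AnabelianGeometry.EtaleTheta.Discharge.Sec2CuspStabSectionDatum
import Literature.AnabelianGeometry.EtaleTheta.Discharge.Sec2Cor29ChiCuspSectionDatumNegative
import Literature.AnabelianGeometry.EtaleTheta.Discharge.Sec2Rmk261DottedChiCuspOfOdd
import HarnessLib

/-!
# [EtTh] Cor. 2.9 COUNT AT `χ′` for the R312 cover of record: ALL SIX `Aut_K`-orbit counts equal ONE, and the ∃-packaged `χ′`
# census with the Cor. 2.9 column filled in negatively (proof-only; node EtTh:Cor2.9, row (w2c), file 2/2)

S. Mochizuki, *The étale theta function and its Frobenioid-theoretic manifestations*, Publ. RIMS **45** (2009) [EtTh], §1 p. 12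
(`Π^tp_X`), §2 Cor. 2.9 p. 43 («for each of `Ẋ̲̲, Ċ̲, Ċ̲̲, X̲̲, C̲, C̲̲` … `(ℤ/lℤ)^±` … `Aut_K(−)`-orbits») [cite: MochizukiEtTh2009, Cor 2.9 p.43].
Cell abc-iut, layer L2, seat abc-iut-L2-d3 (gen 8), node EtTh:Cor2.9, L2-lead row (w2c) «COR29 COUNT AT χ′» (R924), file 2/2. PROOF-ONLY (no
definition, no instance, no `Prop` fact). COMPLEMENT — nothing restated — of abc-iut-L2-t12's census of record p489101
`Sec2Cor29ChiCuspSectionDatumNegative` (finding F-L2t12g9-1: at `χ′`, `¬ hC1`, `#(Aut_K(C̲)-orbits) = 1`, `¬ Cor29_card` for THE R312 cover of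
record), using file 1/2 `Sec2CuspStabSectionDatum` (the interface-level collapse + the R312 constructor's `cuspStabC` for ANY
`MuTwoSetting` / section / commuting element). Inputs BY NAME: p489101's `inr_mul_inl_gfpOf_zero` (`a` commutes with the Galois section)
and `toZ_inl_gfpOf_zero` (`toZ a = 1`), file 1/2's `temperedCoverDataOfHuuOfSection_natCard_cuspOrbits_six_eq_one`, the `χ′` plumbing of
`Sec2HasMuLModelChiCusp` / `Sec2Rmk261DottedChiCuspOfOdd` (THE cover of record = the term of `hasMuL_coverOfRecordχ'`; `sectionχ'`,
`cLevelDataInvχ'`, `nonempty_orbitEmbeddingOfHuuOfSection`, `temperedCoverDataOfHuuOfSection_rmk261_dotted_of_odd`).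

WHAT IS NEW HERE (beyond p489101's member `C̲`): **each of the SIX members `Ẋ̲̲, Ċ̲, Ċ̲̲, X̲̲, C̲, C̲̲` of THE R312 cover of record at `χ′`
has exactly ONE `Aut_K`-orbit of cusps** (odd `l ∣ p − 1`, which makes `HasMuL` TRUE; `natCard_cuspOrbits_six_coverOfRecordχ'_eq_one` —
the dotted members and `X̲̲`/`C̲̲` need the printed definition `hΘ` of `Δ̄_Θ`, a THEOREM for the constructor, and the Prop-2.6-free dotted
normalisers of abc-iut-L2-t12's p484113), and the ∃-packaged `χ′` census of record with the Cor. 2.9 column filled in NEGATIVELY: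
`exists_orbitEmbedding_hasMuL_rmk261_dotted_six_eq_one_not_cor29_inversionModelχ'` — OrbitEmbedding ∧ HasMuL ∧ Rmk. 2.6.1 dotted
(p485226) ∧ six counts `= 1` ∧ `¬ Cor29_card`, at ONE `T`, for every odd `l ≥ 3` with `l ∣ p − 1`. (At `κ′` the cusp-law cover has print's
`(l+1)/2` OUTRIGHT, p484548: the two model families DISAGREE on the typed Cor. 2.9 because their cusp data differ — decomposition group of
a cusp vs. the synthetic `D̄_x`-preimage of a section; the χ-models' own cusp is toral, `not_hIx_modelχ'`.)

HONEST FRAMING: refuted-at-a-model for OUR synthetic cusp datum at OUR semi-synthetic model — nothing about [EtTh] Cor. 2.9 in print;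
nothing of [EtTh]/[SemiAnbd] asserted for genuine tempered fundamental groups; no side taken on [IUTchIII] Cor. 3.12; typed ≠ proved;
instantiated ≠ endorsed.
-/

noncomputable section

namespace Literature.AnabelianGeometry.EtaleTheta

open Literature.AnabelianGeometry.SemiGraphs ThetaCovers
open _root_.Topology

namespace SettingModel

open ThetaSetting

variable (p : ℕ) [Fact p.Prime]

/-- `inl a` COMMUTES with the Galois section `sectionχ′` (`σ ↦ inr σ`) of `Π^tp_X(modelχ′) = Γ ⋊_χ G_{ℚ_p}` — abc-iut-L2-t12's
`inr_mul_inl_gfpOf_zero` (p489101) in `Commute` form. [cite: MochizukiEtTh2009, §1 p.12] -/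
theorem commute_inl_gfpOf_zero_sectionχ' (σ : ↥(ThetaSetting.modelχ' p).GK) :
    Commute (SemidirectProduct.inl (gfpOf (FreeGroup.of 0)) : PiTpχ p) (sectionχ' p σ) :=
  (inr_mul_inl_gfpOf_zero p (σ : GQp p)).symm

section CoverOfRecord

variable {E : (ThetaSetting.modelχ' p).EtaleThetaData} {l : ℕ+} (hodd : Odd (l : ℕ)) (C : E.DoubleUnderline (l : ℕ))
  (eX : (ThetaSetting.modelχ' p).OncePuncturedData) (hK : (MuTwoSetting.inversionModelχ' p).barKerTp l ≤ C.Huu)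
  (hsH : ∀ σ, sectionχ' p σ ∈ C.Huu) (hι : C.IotaStable ((cLevelDataInvχ' p).conjX (epsPMInvχ p)))

/-- **THE (w2c) CENSUS AT `χ′`, ALL SIX MEMBERS: each of `Ẋ̲̲, Ċ̲, Ċ̲̲, X̲̲, C̲, C̲̲` of THE R312 cover of record has exactly ONE
`Aut_K`-orbit of cusps** (odd `l ∣ p − 1`, which discharges `μ_l ⊆ K`) — print's count is `(l+1)/2`; abc-iut-L2-t12's p489101 has the member
`C̲`. [cite: MochizukiEtTh2009, Cor 2.9 p.43] -/
theorem natCard_cuspOrbits_six_coverOfRecordχ'_eq_one (hl : (l : ℕ) ∣ p - 1) :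
    let T := (cLevelDataInvχ' p).temperedCoverDataOfHuuOfSection (cLevelDataInvχ' p).toPiCHat
        (cLevelDataInvχ' p).isProfiniteCompletion_toPiCHat (cLevelDataInvχ' p).toPiCHat_injective eX hodd (sectionχ' p)
        (aug_sectionχ' p) (toZ_sectionχ' p) (inv_ell_piCData_inversionModelχ' p l eX)
        ((cLevelDataInvχ' p).map_inclX_GtpXu_normal l (kerToZIsCompactlyGenerated_modelχ' p))
        ((cLevelDataInvχ' p).map_inclX_GtpY_normal (kerToZIsCompactlyGenerated_modelχ' p)) C hK hsH
        (epsPMInvχ_not_mem_range p) hι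
    ∀ S ∈ [T.tp T.PiXuu ⊓ T.PiCdot, T.tp T.PiCu ⊓ T.PiCdot, T.tp T.PiCuu ⊓ T.PiCdot, T.tp T.PiXuu, T.tp T.PiCu,
      T.tp T.PiCuu], Nat.card (T.cuspOrbits S) = 1 :=
  (cLevelDataInvχ' p).temperedCoverDataOfHuuOfSection_natCard_cuspOrbits_six_eq_one _ _ _ eX hodd _ _ _ _ _ _ C hK hsH
    _ hι _ (commute_inl_gfpOf_zero_sectionχ' p) (toZ_inl_gfpOf_zero p : (ThetaSetting.modelχ' p).toZ _ = _)
    (hasMuL_coverOfRecordχ' p hodd hl C eX hK hsH hι)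

end CoverOfRecord

/-- **THE χ′ CENSUS OF RECORD with the Cor. 2.9 column filled in — NEGATIVELY.** For every odd `l ≥ 3` with `l ∣ p − 1`, every
étale-theta datum `E` over `modelχ′`, every `X̲̲` with `Π^tp_{X̲̲} = Huuχ p l` and Def. 1.9 points `τ, τ′`: ONE `TemperedCoverData` `T` on
THE `Π^tp_C` of `inversionModelχ′` with an `OrbitEmbedding C T` (R312), `HasMuL`, Rmk. 2.6.1 dotted (p485226) — AND all six cusp-orbit
counts EQUAL TO ONE, so `¬ T.Cor29_card` (abc-iut-L2-t12's `not_cor29_card_coverOfRecordχ'`, p489101).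
[cite: MochizukiEtTh2009, Cor 2.9 p.43] -/
theorem exists_orbitEmbedding_hasMuL_rmk261_dotted_six_eq_one_not_cor29_inversionModelχ'
    {E : (ThetaSetting.modelχ' p).EtaleThetaData} {l : ℕ+} (hodd : Odd (l : ℕ)) (hl3 : 3 ≤ (l : ℕ))
    (hl : (l : ℕ) ∣ p - 1) (C : E.DoubleUnderline (l : ℕ)) (hC : C.Huu = Huuχ p l)
    (τ τ' : ThetaSetting.NonCuspidalPoint E.toKummerData) :
    ∃ T : TemperedCoverData.{0} l, T.Gtp = (MuTwoSetting.inversionModelχ' p).GtpC ∧ Nonempty (C.OrbitEmbedding T) ∧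
      T.HasMuL ∧ T.Rmk261_dotted ∧
      (∀ S ∈ [T.tp T.PiXuu ⊓ T.PiCdot, T.tp T.PiCu ⊓ T.PiCdot, T.tp T.PiCuu ⊓ T.PiCdot, T.tp T.PiXuu, T.tp T.PiCu,
        T.tp T.PiCuu], Nat.card (T.cuspOrbits S) = 1) ∧
      ¬ T.Cor29_card := by
  obtain ⟨eX⟩ := nonempty_oncePuncturedData_modelχ' p
  have hK : (MuTwoSetting.inversionModelχ' p).barKerTp l ≤ C.Huu := hC ▸ barKerTp_le_Huuχ_inversionModelχ' p l hodd
  have hsH : ∀ σ, sectionχ' p σ ∈ C.Huu := fun σ => by rw [hC]; exact inr_mem_Huuχ p l σ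
  have hMuL := hasMuL_coverOfRecordχ' p hodd hl C eX hK hsH (iotaStable_conjX_epsPMInvχ' p C hC)
  have hl1 : (l : ℕ) ≠ 1 := by omega
  exact ⟨_, rfl, (cLevelDataInvχ' p).nonempty_orbitEmbeddingOfHuuOfSection _ _ _ eX hodd _ _ _ _ _ _ C hK hsH _ _ τ τ',
    hMuL,
    (cLevelDataInvχ' p).temperedCoverDataOfHuuOfSection_rmk261_dotted_of_odd _ _ _ eX hodd _ _ _ _ _ _ C hK hsH _ _,
    natCard_cuspOrbits_six_coverOfRecordχ'_eq_one p hodd C eX hK hsH _ hl,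
    not_cor29_card_coverOfRecordχ' p hodd C eX hK hsH _ hl1 hl⟩

end SettingModel

end Literature.AnabelianGeometry.EtaleTheta

end
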